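import Literature.Analysis.Complex.CauchyTransformBounds
import Mathlib.MeasureTheory.Integral.DominatedConvergence
import Mathlib.Topology.UniformSpace.UniformApproximation
import HarnessLib

/-!
# Elementary potential estimates in the plane (Newtonian kernel `|z|⁻¹`)

Estimates for the kernel `|ζ - z|⁻¹` of the Cauchy transform on discs of `ℂ`, in the form used by
Carleman's integral method for first-order elliptic systems (Hartman–Wintner (1953), §§3–4;
Schulz (1990), §7.1, proof of Thm 7.1.1):

* `lintegral_inv_norm_sub_ball_le` — `∫_{B(c,R)} |ζ - z|⁻¹ dA(z) ≤ 2π (R + |ζ - c|)`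
  (compare with the disc `B(ζ, R + |ζ - c|)`, where the integral is `2π` times the radius,
  `Literature.Analysis.Complex.integral_inv_norm_ball`);
* `lintegral_inv_norm_sub_mul_inv_norm_sub_le` — the "two-pole" estimate
  `∫_{B(c,R)} |z - ζ|⁻¹ |ζ - z₀|⁻¹ dA(ζ) ≤ 8πR |z - z₀|⁻¹` for `z ≠ z₀` in `B̄(c, R)`, from the
  triangle inequality `|z - z₀| ≤ |z - ζ| + |ζ - z₀|` (Schulz (1990), p. 60: "use the identity
  `|(z-ζ)(ζ-z₀)|⁻¹ = |z-z₀|⁻¹ |(z-ζ)⁻¹ + (ζ-z₀)⁻¹|` … and the estimate `∫_{B_R} |z-ζ|⁻¹ ≤ CR`");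
* `integrable_inv_sub_smul` — `z ↦ (ζ - z)⁻¹ • f z` is integrable for `f` bounded, measurable and
  supported in a disc;
* `continuousAt_integral_inv_sub_smul` — the Cauchy-type integral `ζ ↦ ∫ (ζ - z)⁻¹ • f z dA(z)` of
  such an `f` is continuous (split `f` near / far from the point: the near part is `O(δ)` by the
  first estimate, the far part is continuous by dominated convergence).

All statements about nonnegative quantities are in `ℝ≥0∞` (`∫⁻`), which is how the Carleman
bootstrap (`Literature/Analysis/Complex/HartmanWintnerBootstrap.lean`) consumes them (Tonelli).

## References

* P. Hartman, A. Wintner, *On the local behavior of solutions of non-parabolic partial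
  differential equations*, Amer. J. Math. 75 (1953), 449–476. [HartmanWintner1953]
* F. Schulz, *Regularity theory for quasilinear elliptic systems and Monge–Ampère equations in two
  dimensions*, LNM 1445 (1990), §7.1. [SchulzRegularity1990]
-/

noncomputable section

open MeasureTheory Metric Set Filter Topology
open scoped Real ENNReal

namespace Literature.Analysis.Complex

variable {F : Type*} [NormedAddCommGroup F] [NormedSpace ℂ F]

/-! ### The kernel `|t|⁻¹` on discs -/

/-- `∫⁻_{|t| < a} |t|⁻¹ dA(t) = 2πa`, the `ℝ≥0∞`-valued form of
`Literature.Analysis.Complex.integral_inv_norm_ball`. [folklore] -/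
theorem lintegral_inv_norm_ball {a : ℝ} (ha : 0 ≤ a) :
    ∫⁻ t in ball (0 : ℂ) a, ENNReal.ofReal ‖t‖⁻¹ = ENNReal.ofReal (2 * π * a) := by
  rw [← integral_inv_norm_ball ha, ofReal_integral_eq_lintegral_ofReal (integrableOn_inv_norm_ball a)
    (Eventually.of_forall fun t => inv_nonneg.2 (norm_nonneg t))]

/-- Translating the disc: `∫⁻_{B(ζ, a)} |z - ζ|⁻¹ dA(z) = 2πa`. [folklore] -/
theorem lintegral_inv_norm_sub_ball_self (ζ : ℂ) {a : ℝ} (ha : 0 ≤ a) :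
    ∫⁻ z in ball ζ a, ENNReal.ofReal ‖z - ζ‖⁻¹ = ENNReal.ofReal (2 * π * a) := by
  rw [← lintegral_inv_norm_ball ha, ← lintegral_indicator measurableSet_ball,
    ← lintegral_indicator measurableSet_ball]
  have h : (ball ζ a).indicator (fun z : ℂ => ENNReal.ofReal ‖z - ζ‖⁻¹) =
      fun z => (ball (0 : ℂ) a).indicator (fun t => ENNReal.ofReal ‖t‖⁻¹) (z - ζ) := by
    funext z
    by_cases hz : z ∈ ball ζ a
    · rw [indicator_of_mem hz, indicator_of_mem (mem_ball_zero_iff.2 (mem_ball_iff_norm.1 hz))]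
    · rw [indicator_of_notMem hz,
        indicator_of_notMem (fun h => hz (mem_ball_iff_norm.2 (mem_ball_zero_iff.1 h)))]
  rw [h, lintegral_sub_right_eq_self (fun t => (ball (0 : ℂ) a).indicator
    (fun t => ENNReal.ofReal ‖t‖⁻¹) t) ζ]

/-- **`∫_{B(c,R)} |ζ - z|⁻¹ dA(z) ≤ 2π (R + |ζ - c|)`**: the disc `B(c, R)` is contained in
`B(ζ, R + |ζ - c|)`, on which the integral of `|ζ - z|⁻¹` is `2π (R + |ζ - c|)`
(Schulz (1990), p. 60, the estimate `∫_{B_R} |z - ζ|⁻¹ dx dy ≤ C R`). [cite: SchulzRegularity1990, §7.1 (proof of Thm 7.1.1)] -/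
theorem lintegral_inv_norm_sub_ball_le (c ζ : ℂ) {R : ℝ} (hR : 0 ≤ R) :
    ∫⁻ z in ball c R, ENNReal.ofReal ‖ζ - z‖⁻¹ ≤ ENNReal.ofReal (2 * π * (R + ‖ζ - c‖)) := by
  have hsub : ball c R ⊆ ball ζ (R + ‖ζ - c‖) := fun z hz => by
    rw [mem_ball_iff_norm] at hz ⊢
    calc ‖z - ζ‖ = ‖(z - c) - (ζ - c)‖ := by ring_nf
      _ ≤ ‖z - c‖ + ‖ζ - c‖ := norm_sub_le _ _
      _ < R + ‖ζ - c‖ := by linarith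
  calc ∫⁻ z in ball c R, ENNReal.ofReal ‖ζ - z‖⁻¹
      ≤ ∫⁻ z in ball ζ (R + ‖ζ - c‖), ENNReal.ofReal ‖ζ - z‖⁻¹ := lintegral_mono_set hsub
    _ = ∫⁻ z in ball ζ (R + ‖ζ - c‖), ENNReal.ofReal ‖z - ζ‖⁻¹ := by simp_rw [norm_sub_rev ζ]
    _ = ENNReal.ofReal (2 * π * (R + ‖ζ - c‖)) :=
        lintegral_inv_norm_sub_ball_self ζ (by positivity)

/-- Variant with the other order of subtraction: `∫_{B(c,R)} |z - ζ|⁻¹ dA(z) ≤ 2π (R + |ζ - c|)`.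
[folklore] -/
theorem lintegral_inv_norm_sub_ball_le' (c ζ : ℂ) {R : ℝ} (hR : 0 ≤ R) :
    ∫⁻ z in ball c R, ENNReal.ofReal ‖z - ζ‖⁻¹ ≤ ENNReal.ofReal (2 * π * (R + ‖ζ - c‖)) := by
  simp_rw [norm_sub_rev _ ζ]
  exact lintegral_inv_norm_sub_ball_le c ζ hR

/-! ### The two-pole estimate -/

/-- Pointwise: `|z - ζ|⁻¹ |ζ - z₀|⁻¹ ≤ |z - z₀|⁻¹ (|z - ζ|⁻¹ + |ζ - z₀|⁻¹)` for `z ≠ z₀` (triangle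
inequality; with the convention `0⁻¹ = 0` the cases `ζ = z`, `ζ = z₀` are trivial). [folklore] -/
theorem inv_norm_sub_mul_inv_norm_sub_le {z z₀ : ℂ} (hne : z ≠ z₀) (ζ : ℂ) :
    ‖z - ζ‖⁻¹ * ‖ζ - z₀‖⁻¹ ≤ ‖z - z₀‖⁻¹ * (‖z - ζ‖⁻¹ + ‖ζ - z₀‖⁻¹) := by
  have h0 : 0 < ‖z - z₀‖ := norm_pos_iff.2 (sub_ne_zero.2 hne)
  by_cases h1 : z - ζ = 0
  · simp [h1]
    positivity
  by_cases h2 : ζ - z₀ = 0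
  · simp [h2]
    positivity
  have h1' : 0 < ‖z - ζ‖ := norm_pos_iff.2 h1
  have h2' : 0 < ‖ζ - z₀‖ := norm_pos_iff.2 h2
  have htri : ‖z - z₀‖ ≤ ‖z - ζ‖ + ‖ζ - z₀‖ := by
    calc ‖z - z₀‖ = ‖(z - ζ) + (ζ - z₀)‖ := by ring_nf
      _ ≤ ‖z - ζ‖ + ‖ζ - z₀‖ := norm_add_le _ _
  rw [mul_add]
  have e1 : ‖z - z₀‖⁻¹ * ‖z - ζ‖⁻¹ = ‖ζ - z₀‖ * (‖z - z₀‖⁻¹ * ‖z - ζ‖⁻¹ * ‖ζ - z₀‖⁻¹) := by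
    field_simp
  have e2 : ‖z - z₀‖⁻¹ * ‖ζ - z₀‖⁻¹ = ‖z - ζ‖ * (‖z - z₀‖⁻¹ * ‖z - ζ‖⁻¹ * ‖ζ - z₀‖⁻¹) := by
    field_simp
  have e3 : ‖z - ζ‖⁻¹ * ‖ζ - z₀‖⁻¹ = ‖z - z₀‖ * (‖z - z₀‖⁻¹ * ‖z - ζ‖⁻¹ * ‖ζ - z₀‖⁻¹) := by
    field_simp
  rw [e1, e2, e3, ← add_mul]
  exact mul_le_mul_of_nonneg_right (htri.trans_eq (add_comm _ _)) (by positivity)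

/-- **Two-pole estimate** (Carleman / Hartman–Wintner): for `z ≠ z₀` in the closed disc `B̄(c, R)`,
`∫_{B(c,R)} |z - ζ|⁻¹ |ζ - z₀|⁻¹ dA(ζ) ≤ 8πR · |z - z₀|⁻¹` (each of the two discs integrals after
the pointwise splitting is `≤ 2π (R + R)`). [cite: SchulzRegularity1990, §7.1 (proof of Thm 7.1.1)] -/
theorem lintegral_inv_norm_sub_mul_inv_norm_sub_le {c z z₀ : ℂ} {R : ℝ} (hR : 0 ≤ R)
    (hz : ‖z - c‖ ≤ R) (hz₀ : ‖z₀ - c‖ ≤ R) (hne : z ≠ z₀) :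
    ∫⁻ ζ in ball c R, ENNReal.ofReal (‖z - ζ‖⁻¹ * ‖ζ - z₀‖⁻¹) ≤
      ENNReal.ofReal (8 * π * R * ‖z - z₀‖⁻¹) := by
  have hmeas : Measurable fun ζ : ℂ => ENNReal.ofReal (‖z - z₀‖⁻¹ * ‖z - ζ‖⁻¹) := by fun_prop
  calc ∫⁻ ζ in ball c R, ENNReal.ofReal (‖z - ζ‖⁻¹ * ‖ζ - z₀‖⁻¹)
      ≤ ∫⁻ ζ in ball c R, ENNReal.ofReal (‖z - z₀‖⁻¹ * ‖z - ζ‖⁻¹) +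
          ENNReal.ofReal (‖z - z₀‖⁻¹ * ‖ζ - z₀‖⁻¹) := by
        refine lintegral_mono fun ζ => ?_
        rw [← ENNReal.ofReal_add (by positivity) (by positivity), ← mul_add]
        exact ENNReal.ofReal_le_ofReal (inv_norm_sub_mul_inv_norm_sub_le hne ζ)
    _ = ENNReal.ofReal ‖z - z₀‖⁻¹ * (∫⁻ ζ in ball c R, ENNReal.ofReal ‖z - ζ‖⁻¹) +
          ENNReal.ofReal ‖z - z₀‖⁻¹ * (∫⁻ ζ in ball c R, ENNReal.ofReal ‖ζ - z₀‖⁻¹) := by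
        rw [lintegral_add_left hmeas]
        simp_rw [ENNReal.ofReal_mul (inv_nonneg.2 (norm_nonneg (z - z₀)))]
        rw [lintegral_const_mul' _ _ ENNReal.ofReal_ne_top,
          lintegral_const_mul' _ _ ENNReal.ofReal_ne_top]
    _ ≤ ENNReal.ofReal ‖z - z₀‖⁻¹ * ENNReal.ofReal (2 * π * (R + R)) +
          ENNReal.ofReal ‖z - z₀‖⁻¹ * ENNReal.ofReal (2 * π * (R + R)) := by
        have h1 : (∫⁻ ζ in ball c R, ENNReal.ofReal ‖z - ζ‖⁻¹) ≤
            ENNReal.ofReal (2 * π * (R + R)) :=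
          calc (∫⁻ ζ in ball c R, ENNReal.ofReal ‖z - ζ‖⁻¹)
              ≤ ENNReal.ofReal (2 * π * (R + ‖z - c‖)) := lintegral_inv_norm_sub_ball_le c z hR
            _ ≤ ENNReal.ofReal (2 * π * (R + R)) := by gcongr
        have h2 : (∫⁻ ζ in ball c R, ENNReal.ofReal ‖ζ - z₀‖⁻¹) ≤
            ENNReal.ofReal (2 * π * (R + R)) :=
          calc (∫⁻ ζ in ball c R, ENNReal.ofReal ‖ζ - z₀‖⁻¹)
              ≤ ENNReal.ofReal (2 * π * (R + ‖z₀ - c‖)) := lintegral_inv_norm_sub_ball_le' c z₀ hR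
            _ ≤ ENNReal.ofReal (2 * π * (R + R)) := by gcongr
        gcongr
    _ = ENNReal.ofReal (8 * π * R * ‖z - z₀‖⁻¹) := by
        rw [← ENNReal.ofReal_mul (by positivity), ← ENNReal.ofReal_add (by positivity)
          (by positivity)]
        congr 1
        ring

/-! ### Integrability and continuity of Cauchy-type integrals of bounded densities -/

/-- `z ↦ |z - ζ|⁻¹` is integrable on every disc `B(ζ, a)`. [folklore] -/
theorem integrableOn_inv_norm_sub_ball_self (ζ : ℂ) (a : ℝ) :
    IntegrableOn (fun z : ℂ => ‖z - ζ‖⁻¹) (ball ζ a) := by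
  have h := (integrableOn_inv_norm_ball a).integrable_indicator measurableSet_ball
  rw [← integrable_indicator_iff measurableSet_ball]
  have e : (ball ζ a).indicator (fun z : ℂ => ‖z - ζ‖⁻¹) =
      fun z => (ball (0 : ℂ) a).indicator (fun t => ‖t‖⁻¹) (z - ζ) := by
    funext z
    by_cases hz : z ∈ ball ζ a
    · rw [indicator_of_mem hz, indicator_of_mem (mem_ball_zero_iff.2 (mem_ball_iff_norm.1 hz))]
    · rw [indicator_of_notMem hz,
        indicator_of_notMem (fun h => hz (mem_ball_iff_norm.2 (mem_ball_zero_iff.1 h)))]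
  rw [e]
  exact h.comp_sub_right ζ

/-- `z ↦ |ζ - z|⁻¹` is integrable on every disc `B(c, R)`. [folklore] -/
theorem integrableOn_inv_norm_sub_ball (c ζ : ℂ) (R : ℝ) :
    IntegrableOn (fun z : ℂ => ‖ζ - z‖⁻¹) (ball c R) := by
  have hsub : ball c R ⊆ ball ζ (R + ‖ζ - c‖) := fun z hz => by
    rw [mem_ball_iff_norm] at hz ⊢
    calc ‖z - ζ‖ = ‖(z - c) - (ζ - c)‖ := by ring_nf
      _ ≤ ‖z - c‖ + ‖ζ - c‖ := norm_sub_le _ _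
      _ < R + ‖ζ - c‖ := by linarith
  have h := (integrableOn_inv_norm_sub_ball_self ζ (R + ‖ζ - c‖)).mono_set hsub
  simp_rw [norm_sub_rev _ ζ] at h
  exact h

/-- **Integrability of the Cauchy-type integrand.** If `f` is (a.e. strongly) measurable, bounded,
and vanishes off the disc `B(0, R)`, then `z ↦ (ζ - z)⁻¹ • f z` is integrable for every `ζ`.
[folklore] -/
theorem integrable_inv_sub_smul {f : ℂ → F} (hf : AEStronglyMeasurable f volume) {N R : ℝ}
    (hN : ∀ z, ‖f z‖ ≤ N) (hsupp : ∀ z, f z ≠ 0 → ‖z‖ < R) (ζ : ℂ) :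
    Integrable fun z : ℂ => (ζ - z)⁻¹ • f z := by
  have hmeas : AEStronglyMeasurable (fun z : ℂ => (ζ - z)⁻¹ • f z) volume :=
    ((measurable_const.sub measurable_id).inv.aestronglyMeasurable).smul hf
  refine Integrable.mono' (g := fun z => (ball (0 : ℂ) R).indicator (fun z => N * ‖ζ - z‖⁻¹) z)
    ?_ hmeas (Eventually.of_forall fun z => ?_)
  · exact IntegrableOn.integrable_indicator
      ((integrableOn_inv_norm_sub_ball 0 ζ R).const_mul N) measurableSet_ball
  · by_cases hz : f z = 0
    · rw [hz, smul_zero, norm_zero]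
      exact indicator_nonneg (fun y _ => mul_nonneg ((norm_nonneg _).trans (hN y))
        (inv_nonneg.2 (norm_nonneg _))) z
    · rw [indicator_of_mem (mem_ball_zero_iff.2 (hsupp z hz)), norm_smul, norm_inv, mul_comm]
      exact mul_le_mul_of_nonneg_right (hN z) (inv_nonneg.2 (norm_nonneg _))

/-- Norm bound for the Cauchy-type integral of a density bounded by `N` on the disc `B(c, δ)` and
vanishing off it: `‖∫ (ζ - z)⁻¹ • f z dA(z)‖ ≤ N · 2π (δ + |ζ - c|)`. [folklore] -/
theorem norm_integral_inv_sub_smul_le {f : ℂ → F} {N δ : ℝ} (hN : 0 ≤ N) (hδ : 0 ≤ δ) (c : ℂ)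
    (hbound : ∀ z, ‖f z‖ ≤ N) (hsupp : ∀ z, f z ≠ 0 → z ∈ ball c δ) (ζ : ℂ) :
    ‖∫ z, (ζ - z)⁻¹ • f z‖ ≤ N * (2 * π * (δ + ‖ζ - c‖)) := by
  refine (norm_integral_le_lintegral_norm _).trans ?_
  refine ENNReal.toReal_le_of_le_ofReal (by positivity) ?_
  calc ∫⁻ z, ENNReal.ofReal ‖(ζ - z)⁻¹ • f z‖
      ≤ ∫⁻ z, (ball c δ).indicator (fun z => ENNReal.ofReal N * ENNReal.ofReal ‖ζ - z‖⁻¹) z := by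
        refine lintegral_mono fun z => ?_
        by_cases hz : f z = 0
        · simp [hz]
        · rw [indicator_of_mem (hsupp z hz), norm_smul, norm_inv, mul_comm,
            ← ENNReal.ofReal_mul hN]
          exact ENNReal.ofReal_le_ofReal (mul_le_mul_of_nonneg_right (hbound z)
            (inv_nonneg.2 (norm_nonneg _)))
    _ = ENNReal.ofReal N * ∫⁻ z in ball c δ, ENNReal.ofReal ‖ζ - z‖⁻¹ := by
        rw [lintegral_indicator measurableSet_ball,
          lintegral_const_mul' _ _ ENNReal.ofReal_ne_top]
    _ ≤ ENNReal.ofReal N * ENNReal.ofReal (2 * π * (δ + ‖ζ - c‖)) := by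
        gcongr
        exact lintegral_inv_norm_sub_ball_le c ζ hδ
    _ = ENNReal.ofReal (N * (2 * π * (δ + ‖ζ - c‖))) := by rw [← ENNReal.ofReal_mul hN]

/-- **Continuity of Cauchy-type integrals of bounded densities.** If `f : ℂ → F` is measurable,
bounded, and vanishes off a disc, then `ζ ↦ ∫ (ζ - z)⁻¹ • f z dA(z)` is continuous at every point
`ζ₀` (near part `O(δ)` uniformly, far part continuous by dominated convergence). This is the
continuity of the area term in the Cauchy–Green representation used by Hartman–Wintner to define
the limit `lim_{z → 0} w(z) z^{-k}`. [folklore] -/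
theorem continuousAt_integral_inv_sub_smul {f : ℂ → F} (hf : AEStronglyMeasurable f volume)
    {N R : ℝ} (hN : ∀ z, ‖f z‖ ≤ N) (hsupp : ∀ z, f z ≠ 0 → ‖z‖ < R) (ζ₀ : ℂ) :
    ContinuousAt (fun ζ => ∫ z, (ζ - z)⁻¹ • f z) ζ₀ := by
  have hN0 : 0 ≤ N := (norm_nonneg _).trans (hN 0)
  refine continuousAt_of_locally_uniform_approx_of_continuousAt fun u hu => ?_
  obtain ⟨ε, hε, hεu⟩ := Metric.mem_uniformity_dist.1 hu
  -- choose `δ > 0` with `N · 2π · 2δ < ε`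
  obtain ⟨δ, hδ, hδε⟩ : ∃ δ : ℝ, 0 < δ ∧ N * (2 * π * (δ + δ)) < ε := by
    refine ⟨ε / (8 * π * (N + 1)), by positivity, ?_⟩
    have hπ := Real.pi_pos
    rw [show N * (2 * π * (ε / (8 * π * (N + 1)) + ε / (8 * π * (N + 1)))) =
      ε * (N / (2 * (N + 1))) by field_simp; ring]
    have : N / (2 * (N + 1)) < 1 := by
      rw [div_lt_one (by positivity)]; linarith
    nlinarith
  -- near and far parts of the density
  set fn : ℂ → F := (ball ζ₀ δ).indicator f with hfn
  set ff : ℂ → F := (ball ζ₀ δ)ᶜ.indicator f with hff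
  have hsplit : ∀ z, f z = fn z + ff z := fun z =>
    (Set.indicator_self_add_compl_apply (ball ζ₀ δ) f z).symm
  have hfn_meas : AEStronglyMeasurable fn volume := hf.indicator measurableSet_ball
  have hff_meas : AEStronglyMeasurable ff volume := hf.indicator measurableSet_ball.compl
  have hfn_bd : ∀ z, ‖fn z‖ ≤ N := fun z =>
    (norm_indicator_le_norm_self _ _).trans (hN z)
  have hff_bd : ∀ z, ‖ff z‖ ≤ N := fun z =>
    (norm_indicator_le_norm_self _ _).trans (hN z)
  have hfn_supp : ∀ z, fn z ≠ 0 → ‖z‖ < R := fun z hz =>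
    hsupp z (fun h => hz (by simp [hfn, h]))
  have hff_supp : ∀ z, ff z ≠ 0 → ‖z‖ < R := fun z hz =>
    hsupp z (fun h => hz (by simp [hff, h]))
  have hfn_supp' : ∀ z, fn z ≠ 0 → z ∈ ball ζ₀ δ := fun z hz => by
    by_contra h
    exact hz (indicator_of_notMem h f)
  -- the far part is continuous at `ζ₀` by dominated convergence
  have hfar : ContinuousAt (fun ζ => ∫ z, (ζ - z)⁻¹ • ff z) ζ₀ := by
    refine continuousAt_of_dominated (bound := fun z =>
      (ball (0 : ℂ) R).indicator (fun _ => (2 / δ) * N) z) ?_ ?_ ?_ ?_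
    · exact Eventually.of_forall fun ζ =>
        ((measurable_const.sub measurable_id).inv.aestronglyMeasurable).smul hff_meas
    · have hball : ball ζ₀ (δ / 2) ∈ 𝓝 ζ₀ := ball_mem_nhds _ (by positivity)
      filter_upwards [hball] with ζ hζ
      refine Eventually.of_forall fun z => ?_
      by_cases hz : ff z = 0
      · rw [hz, smul_zero, norm_zero]
        exact indicator_nonneg (fun _ _ => by positivity) z
      rw [indicator_of_mem (mem_ball_zero_iff.2 (hff_supp z hz)), norm_smul, norm_inv]
      have hzfar : δ ≤ ‖z - ζ₀‖ := by
        by_contra hlt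
        push Not at hlt
        exact hz (indicator_of_notMem (fun h : z ∈ (ball ζ₀ δ)ᶜ => h (mem_ball_iff_norm.2 hlt)) f)
      have hζ' : ‖ζ - ζ₀‖ < δ / 2 := mem_ball_iff_norm.1 hζ
      have hdist : δ / 2 ≤ ‖ζ - z‖ := by
        have := norm_sub_le_norm_sub_add_norm_sub z ζ ζ₀
        have h2 : ‖z - ζ‖ = ‖ζ - z‖ := norm_sub_rev _ _
        linarith
      calc ‖ζ - z‖⁻¹ * ‖ff z‖ ≤ (δ / 2)⁻¹ * N :=
            mul_le_mul (inv_anti₀ (by positivity) hdist) (hff_bd z) (norm_nonneg _)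
              (by positivity)
        _ = 2 / δ * N := by rw [inv_div]
    · exact (integrableOn_const (measure_ball_lt_top (x := (0 : ℂ)) (r := R)).ne).integrable_indicator
        measurableSet_ball
    · refine Eventually.of_forall fun z => ?_
      by_cases hz : ff z = 0
      · simp only [hz, smul_zero]
        exact continuousAt_const
      · have hzfar : δ ≤ ‖z - ζ₀‖ := by
          by_contra hlt
          push Not at hlt
          exact hz (indicator_of_notMem (fun h : z ∈ (ball ζ₀ δ)ᶜ => h (mem_ball_iff_norm.2 hlt)) f)
        have hne : ζ₀ - z ≠ 0 := by
          intro h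
          rw [sub_eq_zero] at h
          rw [h, sub_self, norm_zero] at hzfar
          linarith
        exact ((continuousAt_id.sub continuousAt_const).inv₀ hne).smul continuousAt_const
  refine ⟨ball ζ₀ δ, ball_mem_nhds _ hδ, fun ζ => ∫ z, (ζ - z)⁻¹ • ff z, hfar, fun ζ hζ => ?_⟩
  apply hεu
  -- the near part is uniformly small on `B(ζ₀, δ)`
  have hint_n := integrable_inv_sub_smul hfn_meas hfn_bd hfn_supp ζ
  have hint_f := integrable_inv_sub_smul hff_meas hff_bd hff_supp ζ
  have hdecomp : ∫ z, (ζ - z)⁻¹ • f z = (∫ z, (ζ - z)⁻¹ • fn z) + ∫ z, (ζ - z)⁻¹ • ff z := by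
    rw [← integral_add hint_n hint_f]
    congr 1
    funext z
    rw [← smul_add, ← hsplit z]
  rw [dist_eq_norm, hdecomp, add_sub_cancel_right]
  calc ‖∫ z, (ζ - z)⁻¹ • fn z‖ ≤ N * (2 * π * (δ + ‖ζ - ζ₀‖)) :=
        norm_integral_inv_sub_smul_le hN0 hδ.le ζ₀ hfn_bd hfn_supp' ζ
    _ ≤ N * (2 * π * (δ + δ)) := by
        gcongr
        exact (mem_ball_iff_norm.1 hζ).le
    _ < ε := hδε

end Literature.Analysis.Complex

end
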